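import Summits.HodgeConjecture.HodgeConjecture.Theorems.NikulinTwinTransportSquareGlueFreeNeronSeveri
import Summits.HodgeConjecture.HodgeConjecture.Theorems.NikulinTwinTransportSquareTypeTwoTwo

/-!
# Route NikulinTwinTransport · `SquareGlue` (stmt-HodgeConjecture-13682) — marking-free bookkeeping II:
# the action of a rational `(2,2)`-class of `S × S` on `H²(S)` is induced by an ALGEBRAIC class

Second of three files replacing the marking (`Huybrechts_K3_marking_exists`) and `b₁ = 0`
(`Huybrechts_K3_oddBetti_vanish`) in the landed conditional proof of `SquareGlue` by fact-free
arguments, for EVERY smooth projective complex surface `S` and every orientation family `μ`: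

* `cupProduct_corrFst_eq_zero_of_orthogonal` — **`Hom_Hdg(T, NS) = 0` in correspondence form**: for a
  rational `(2,2)`-class `z` on `S × S`, the action `[z]_* y = pr₁_*(pr₂^* y ∪ z)` of a TRANSCENDENTAL
  class `y` (`y ∪ d = 0` for all `d ∈ N = N¹H²`) is again cup-orthogonal to `N`. By the transposition
  identities `⟨[z]_* y, d⟩_S = ±⟨z, pr₁^* d ∪ pr₂^* y⟩_{S×S} = ±⟨[z]^* d, y⟩_S` (`cupPairing_corrFst_eq`,
  `cupPairing_corrSnd_eq`, landed), and `[z]^* d = pr₂_*(pr₁^* d ∪ z)` is (up to the orientation scalar)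
  a rational `(1,1)`-class, i.e. a divisor class by Lefschetz `(1,1)` (`lefschetzOneOne_rational_holds`),
  orthogonal to `y`.
* `exists_algebraicClass_of_corrFst` — **the endomorphism theorem**: on the sector (`e` a rational
  endomorphism of `H²(S)` killing `N` with algebraic class `γₑ`, and the uniqueness clause `hU` of
  `SquareHodgeOfSqrtTwo`: rational Hodge endomorphisms killing `N` with image in `T` are `a + b e` on `T`),
  for every rational `(2,2)`-class `z` on `S × S` there is an ALGEBRAIC `Γ ∈ N²H⁴(S × S)` with
  `[Γ]_* = [z]_*` on `H²(S)`. Proof: `F = u[z]_*` is rational and type-preserving; `π_T F π_T`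
  (`π_T = 1 - π_N`, bookkeeping I) satisfies `hU`, so `F = a + b e` on `T` (the `N`-component of `F|_T`
  vanishes by the first theorem); `F - a - b e` kills `T` and maps the rational divisor basis `dᵢ` to
  divisor classes `cᵢ` (Lefschetz `(1,1)`), so it is the action of the algebraic class
  `κ⁻¹ Σᵢ pr₁^* cᵢ ∪ pr₂^* dᵢ^∨` (`dᵢ^∨` the Gram-dual basis; `corrFst_cross_of_cup_eq`); the diagonal acts
  as the identity (`corrFst_diagonal`) and `γₑ` as `e`.

No definition, no named-fact hypothesis, no sorry. Prover seat ring2-b02 (gen 47).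

References: Varesco, *Hodge similitudes and the Hodge conjecture for squares of K3 surfaces* (2023), §2
p. 8; Huybrechts, *Motives of isogenous K3 surfaces* (2019), §1; Voisin, *Hodge Theory and Complex
Algebraic Geometry I*, §11.3.3 Lemma 11.41, Thm. 11.30; Fulton, *Young Tableaux*, App. B §B.1.
-/

set_option linter.dupNamespace false

noncomputable section

namespace Summit.HodgeConjecture.HodgeConjecture.Theorems.NikulinTwinTransport.SquareGlueFree

open scoped Manifold
open CategoryTheory MonoidalCategory CartesianMonoidalCategory
open Literature.AlgebraicGeometry.Motives Literature.AlgebraicGeometry.HodgeTheory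
open Literature.AlgebraicTopology.SingularHomology

variable {S : SchemeOver ℂ}


/-- `Corr[μ, hS ; γ, y] = pr₁_*(pr₂^* y ∪ γ)` on `H²(S(ℂ); ℂ)` — the route's shape of the action of a class
`γ ∈ H⁴((S ⊗ S)(ℂ))` (as in `RealMultiplicationSqrtTwoAlgebraic`). Local notation only. -/
local notation3 (prettyPrint := false) "Corr[" μ ", " hS " ; " γ ", " y "]" =>
  complexGysin μ (IsSmoothProjective.tensor_holds hS hS) hS
    (SemiCartesianMonoidalCategory.fst _ _) (rfl : 2 * 1 + 2 * 2 + 2 * 2 = 2 * 1 + 2 * (2 + 2))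
    (cupProduct (rfl : 2 * 1 + 2 * 2 = 2 * 1 + 2 * 2)
      (complexBetti.map (SemiCartesianMonoidalCategory.snd _ _) (2 * 1) y) γ)

/-- `CorrT[μ, hS ; γ, d] = pr₂_*(pr₁^* d ∪ γ)` on `H²(S(ℂ); ℂ)` — the transposed action. Local notation only. -/
local notation3 (prettyPrint := false) "CorrT[" μ ", " hS " ; " γ ", " d "]" =>
  complexGysin μ (IsSmoothProjective.tensor_holds hS hS) hS
    (SemiCartesianMonoidalCategory.snd _ _) (rfl : 2 * 1 + 2 * 2 + 2 * 2 = 2 * 1 + 2 * (2 + 2))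
    (cupProduct (rfl : 2 * 1 + 2 * 2 = 2 * 1 + 2 * 2)
      (complexBetti.map (SemiCartesianMonoidalCategory.fst _ _) (2 * 1) d) γ)

/-! ### `Hom_Hdg(T, NS) = 0`, correspondence form -/

/-- **The action of a rational `(2,2)`-class of `S × S` maps transcendental classes to classes
orthogonal to `N¹H²`.** For `z ∈ H⁴((S ⊗ S)(ℂ))` rational of type `(2,2)`, `y ∈ H²(S(ℂ))` with
`y ∪ d = 0` for all `d ∈ N = algebraicClasses S 1`, and `d ∈ N`: `pr₁_*(pr₂^* y ∪ z) ∪ d = 0`. Indeed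
`⟨pr₁_*(pr₂^* y ∪ z), d⟩ = ±⟨z, pr₁^* d ∪ pr₂^* y⟩ = ±⟨pr₂_*(pr₁^* d ∪ z), y⟩` (`cupPairing_corrFst_eq`,
`cupPairing_corrSnd_eq`), and for rational `d` the class `pr₂_*(pr₁^* d ∪ z)` is, up to one non-zero
scalar, rational (`exists_smul_complexGysin_isRationalClass`) and of type `(1,1)` (`isOfHodgeType_corrSnd`),
hence in `N` (`lefschetzOneOne_rational_holds`) and orthogonal to `y`; general `d ∈ N` are combinations
of rational ones. [cite: VoisinHodgeI2002, §11.3.3 Lemma 11.41 and Thm. 11.30]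
[cite: Huybrechts2019, §1] -/
theorem cupProduct_corrFst_eq_zero_of_orthogonal (μ : OrientationFamily) (hS : IsSmoothProjective 2 S)
    {z : complexBetti (S ⊗ S) (2 * 2)} (hzQ : IsRationalClass z)
    (hzT : IsOfHodgeType (2 + 2) (S ⊗ S) (2 * 2) 2 2 z)
    {y : complexBetti S (2 * 1)}
    (hy : ∀ d ∈ algebraicClasses S 1, cupProduct (rfl : 2 * 1 + 2 * 1 = 2 * 2) y d = 0)
    {d : complexBetti S (2 * 1)} (hd : d ∈ algebraicClasses S 1) :
    cupProduct (rfl : 2 * 1 + 2 * 1 = 2 * 2) (Corr[μ, hS ; z, y]) d = 0 := by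
  have h4 : 2 * 1 + 2 * 1 = 2 * 2 := rfl
  have hI := hodgePQ_independent_of_hodgeModel_holds
  have hdR : ∀ (E : Type) [NormedAddCommGroup E] [NormedSpace ℂ E] [FiniteDimensional ℂ E],
      Literature.NumberTheory.Transcendental.exists_deRhamIsoFamily 𝓘(ℝ, E) :=
    fun E _ _ _ ↦ Literature.NumberTheory.Transcendental.exists_deRhamIsoFamily_holds E
  have hSS := IsSmoothProjective.tensor_holds hS hS
  obtain ⟨B, -⟩ := id hzT
  obtain ⟨A⟩ := nonempty_hodgeModel_holds (n := 2) (X := S) hS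
  -- the transposed action is rational up to one scalar
  obtain ⟨u, hu0, hu⟩ := exists_smul_complexGysin_isRationalClass μ hSS hS (snd S S)
    (rfl : 2 * 1 + 2 * 2 + 2 * 2 = 2 * 1 + 2 * (2 + 2))
  -- the statement for RATIONAL `d ∈ N`
  have key : ∀ d : complexBetti S (2 * 1), IsRationalClass d → d ∈ algebraicClasses S 1 →
      cupProduct h4 (Corr[μ, hS ; z, y]) d = 0 := by
    intro d hdQ hdN
    -- `w = pr₂_*(pr₁^* d ∪ z)`: `u • w` is a rational `(1,1)`-class, hence in `N`
    set w : complexBetti S (2 * 1) := CorrT[μ, hS ; z, d] with hw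
    have hwQ : IsRationalClass (u • w) := hu _ ((IsRationalClass.map _ hdQ).cup _ hzQ)
    have hd11 : IsOfHodgeType 2 S (2 * 1) 1 1 d :=
      isOfHodgeType_of_mem_algebraicClasses_of_isSmoothProjective hS 1 hdN
    have hw11 : IsOfHodgeType 2 S (2 * 1) 1 1 (u • w) := by
      refine (isOfHodgeType_corrSnd hI hdR μ hS hS B A (rfl : 2 * 1 + 2 * 2 = 2 * 1 + 2 * 2)
        (rfl : 2 * 1 + 2 * 2 + 2 * 2 = 2 * 1 + 2 * (2 + 2)) hzT (r' := 1) (l' := 1)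
        (by norm_num) (by norm_num) hd11).smul u
    have hwN : u • w ∈ algebraicClasses S 1 := lefschetzOneOne_rational_holds hS (u • w) hwQ hw11
    -- hence `w ∪ y = 0`
    have hwy : cupProduct h4 w y = 0 := by
      have h1 : cupProduct h4 y (u • w) = 0 := hy _ hwN
      rw [map_smul, smul_eq_zero] at h1
      rw [cupProduct_gradedComm_holds ℂ _ h4 h4, h1.resolve_left hu0, smul_zero]
    -- the two transposition identities
    have e1 := cupPairing_corrFst_eq μ hS hS (k := 2 * 2) (l := 2 * 2) (i := 2 * 1) (j := 2 * 1)
      (rfl : 2 * 2 + 2 * 2 = 2 * (2 + 2)) h4 (rfl : 2 * 1 + 2 * 2 = 2 * 1 + 2 * 2)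
      (rfl : 2 * 1 + 2 * 2 + 2 * 2 = 2 * 1 + 2 * (2 + 2)) h4 z d y
    have e2 := cupPairing_corrSnd_eq μ hS hS (k := 2 * 2) (l := 2 * 2) (i := 2 * 1) (j := 2 * 1)
      (rfl : 2 * 2 + 2 * 2 = 2 * (2 + 2)) h4 (rfl : 2 * 1 + 2 * 2 = 2 * 1 + 2 * 2)
      (rfl : 2 * 1 + 2 * 2 + 2 * 2 = 2 * 1 + 2 * (2 + 2)) h4 z d y
    have h2 : cupPairing (μ hS) h4 (CorrT[μ, hS ; z, d]) y = 0 := by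
      rw [cupPairing_apply, ← hw, hwy, map_zero, LinearMap.zero_apply]
    rw [h2] at e2
    have hz0 : cupPairing (μ hSS) (rfl : 2 * 2 + 2 * 2 = 2 * (2 + 2)) z
        (cupProduct h4 (complexBetti.map (fst S S) (2 * 1) d) (complexBetti.map (snd S S) (2 * 1) y)) = 0 := by
      have hsign : ((-1 : ℂ) ^ (2 * 1 * (2 * 2))) ≠ 0 := pow_ne_zero _ (neg_ne_zero.2 one_ne_zero)
      exact (mul_eq_zero.1 e2.symm).resolve_left hsign
    rw [hz0, mul_zero] at e1
    -- `⟨[z]_* y ∪ d, [S]⟩ = 0` forces `[z]_* y ∪ d = 0`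
    rw [cupPairing_apply] at e1
    exact top_eq_zero_of_kroneckerPairing_eq_zero hS (μ hS) e1
  -- general `d ∈ N`: a combination of rational classes of `N`
  have hspan := span_isRationalClass_eq_top_of_isSmoothProjective_holds.supportedClasses_eq_span hS (2 * 1) 1
  have hd' : d ∈ Submodule.span ℂ {c : complexBetti S (2 * 1) |
      IsRationalClass c ∧ c ∈ supportedClasses S (2 * 1) 1} := by rw [← hspan]; exact hd
  clear hd
  induction hd' using Submodule.span_induction with
  | mem c hc => exact key c hc.1 hc.2
  | zero => rw [map_zero]
  | add c c' _ _ hc hc' => rw [map_add, hc, hc', add_zero]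
  | smul t c _ hc => rw [map_smul, hc, smul_zero]

/-! ### The endomorphism theorem -/

/-- **Every rational `(2,2)`-class of `S × S` acts on `H²(S)` as an ALGEBRAIC class does**, on the
sector of route NikulinTwinTransport and for every smooth projective surface `S` and orientation family
`μ`: given a rational endomorphism `e` of `H²(S(ℂ); ℂ)` killing `N = algebraicClasses S 1` whose class is
algebraic (`e = [γₑ]_*`), and the uniqueness clause `hU` of `SquareHodgeOfSqrtTwo` (rational Hodge
endomorphisms killing `N` with image orthogonal to `N` are `a + b e` on `T = N^⊥`, `a, b ∈ ℚ`), every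
rational class `z ∈ H⁴((S ⊗ S)(ℂ))` of type `(2,2)` has an algebraic `Γ ∈ algebraicClasses (S ⊗ S) 2`
with `pr₁_*(pr₂^* y ∪ Γ) = pr₁_*(pr₂^* y ∪ z)` for all `y ∈ H²(S(ℂ))`. Marking-free replacement of
`exists_algebraicClass_of_hodgeEndomorphism`. [cite: Varesco2023, §2 (p. 8)] [cite: Huybrechts2019, §1]
[cite: VoisinHodgeI2002, §11.3.3 Lemma 11.41] -/
theorem exists_algebraicClass_of_corrFst (μ : OrientationFamily) (hS : IsSmoothProjective 2 S)
    (e : complexBetti S (2 * 1) →ₗ[ℂ] complexBetti S (2 * 1))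
    (he_rat : ∀ y, IsRationalClass y → IsRationalClass (e y))
    (he_N : ∀ d ∈ algebraicClasses S 1, e d = 0)
    (hγe : ∃ γ ∈ algebraicClasses (S ⊗ S) 2, ∀ y : complexBetti S (2 * 1), e y = Corr[μ, hS ; γ, y])
    (hU : ∀ (f : complexBetti S (2 * 1) →ₗ[ℂ] complexBetti S (2 * 1)),
      (∀ y, IsRationalClass y → IsRationalClass (f y)) →
      (∀ (i j : ℕ) y, IsOfHodgeType 2 S (2 * 1) i j y → IsOfHodgeType 2 S (2 * 1) i j (f y)) →
      (∀ d ∈ algebraicClasses S 1, f d = 0) →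
      (∀ y : complexBetti S (2 * 1), ∀ d ∈ algebraicClasses S 1,
        cupProduct (rfl : 2 * 1 + 2 * 1 = 2 * 2) (f y) d = 0) →
      ∃ a b : ℚ, ∀ y : complexBetti S (2 * 1),
        (∀ d ∈ algebraicClasses S 1, cupProduct (rfl : 2 * 1 + 2 * 1 = 2 * 2) y d = 0) →
        f y = (a : ℂ) • y + (b : ℂ) • e y)
    {z : complexBetti (S ⊗ S) (2 * 2)} (hzQ : IsRationalClass z)
    (hzT : IsOfHodgeType (2 + 2) (S ⊗ S) (2 * 2) 2 2 z) :
    ∃ Γ ∈ algebraicClasses (S ⊗ S) 2, ∀ y : complexBetti S (2 * 1),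
      Corr[μ, hS ; Γ, y] = Corr[μ, hS ; z, y] := by
  classical
  have h4 : 2 * 1 + 2 * 1 = 2 * 2 := rfl
  have hI := hodgePQ_independent_of_hodgeModel_holds
  have hdR : ∀ (E : Type) [NormedAddCommGroup E] [NormedSpace ℂ E] [FiniteDimensional ℂ E],
      Literature.NumberTheory.Transcendental.exists_deRhamIsoFamily 𝓘(ℝ, E) :=
    fun E _ _ _ ↦ Literature.NumberTheory.Transcendental.exists_deRhamIsoFamily_holds E
  have hSS := IsSmoothProjective.tensor_holds hS hS
  obtain ⟨B, -⟩ := id hzT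
  obtain ⟨A⟩ := nonempty_hodgeModel_holds (n := 2) (X := S) hS
  set N : Submodule ℂ (complexBetti S (2 * 1)) := algebraicClasses S 1 with hNdef
  have hN11 : ∀ d ∈ N, IsOfHodgeType 2 S (2 * 1) 1 1 d :=
    fun d hd ↦ isOfHodgeType_of_mem_algebraicClasses_of_isSmoothProjective hS 1 hd
  have hL11 : ∀ c : complexBetti S (2 * 1), IsRationalClass c → IsOfHodgeType 2 S (2 * 1) 1 1 c → c ∈ N :=
    fun c hc h11 ↦ lefschetzOneOne_rational_holds hS c hc h11
  -- the action of `z` on `H²(S)` as a linear map, rational up to `u`, type-preserving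
  let Fc : complexBetti S (2 * 1) →ₗ[ℂ] complexBetti S (2 * 1) :=
    (complexGysin μ hSS hS (fst S S) (rfl : 2 * 1 + 2 * 2 + 2 * 2 = 2 * 1 + 2 * (2 + 2))) ∘ₗ
      ((cupProduct (rfl : 2 * 1 + 2 * 2 = 2 * 1 + 2 * 2)).flip z) ∘ₗ (complexBetti.map (snd S S) (2 * 1)).hom
  have hFc : ∀ y, Fc y = Corr[μ, hS ; z, y] := fun y ↦ rfl
  obtain ⟨u, hu0, hu⟩ := exists_smul_complexGysin_isRationalClass μ hSS hS (fst S S)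
    (rfl : 2 * 1 + 2 * 2 + 2 * 2 = 2 * 1 + 2 * (2 + 2))
  set F : complexBetti S (2 * 1) →ₗ[ℂ] complexBetti S (2 * 1) := u • Fc with hFdef
  have hF : ∀ y, F y = u • Corr[μ, hS ; z, y] := fun y ↦ rfl
  have hF_rat : ∀ y, IsRationalClass y → IsRationalClass (F y) := fun y hy ↦ by
    rw [hF]
    exact hu _ (IsRationalClass.cup _ (IsRationalClass.map _ hy) hzQ)
  have hF_typ : ∀ (i j : ℕ) y, IsOfHodgeType 2 S (2 * 1) i j y → IsOfHodgeType 2 S (2 * 1) i j (F y) :=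
    fun i j y hy ↦ by
      rw [hF]
      exact (isOfHodgeType_corrFst hI hdR μ hS hS B A (rfl : 2 * 1 + 2 * 2 = 2 * 1 + 2 * 2)
        (rfl : 2 * 1 + 2 * 2 + 2 * 2 = 2 * 1 + 2 * (2 + 2)) hzT (rfl : i + 2 = i + 2) (rfl : j + 2 = j + 2)
        hy).smul u
  -- `F` maps `T` into `T` (`Hom_Hdg(T, N) = 0`)
  have hF_T : ∀ y, (∀ d ∈ N, cupProduct h4 y d = 0) → ∀ d ∈ N, cupProduct h4 (F y) d = 0 := by
    intro y hy d hd
    rw [hF, map_smul, LinearMap.smul_apply, cupProduct_corrFst_eq_zero_of_orthogonal μ hS hzQ hzT hy hd,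
      smul_zero]
  -- the Néron–Severi projection and `f = π_T F π_T`
  obtain ⟨π, hπN, hπid, hπT, hπorth, hπQ, hπtyp⟩ := exists_nsProjection_free hS
  set f : complexBetti S (2 * 1) →ₗ[ℂ] complexBetti S (2 * 1) :=
    (LinearMap.id - π) ∘ₗ F ∘ₗ (LinearMap.id - π) with hfdef
  have hf : ∀ y, f y = F (y - π y) - π (F (y - π y)) := fun y ↦ by
    simp only [hfdef, LinearMap.comp_apply, LinearMap.sub_apply, LinearMap.id_apply]
  have hf_rat : ∀ y, IsRationalClass y → IsRationalClass (f y) := fun y hy ↦ by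
    rw [hf]
    have h1 : IsRationalClass (F (y - π y)) := hF_rat _ (isRationalClass_sub hy (hπQ y hy))
    exact isRationalClass_sub h1 (hπQ _ h1)
  have hf_typ : ∀ (i j : ℕ) y, IsOfHodgeType 2 S (2 * 1) i j y → IsOfHodgeType 2 S (2 * 1) i j (f y) :=
    fun i j y hy ↦ by
      rw [hf]
      exact (hπtyp i j _ (hF_typ i j _ (hπtyp i j y hy).2)).2
  have hf_N : ∀ d ∈ N, f d = 0 := fun d hd ↦ by
    rw [hf, hπid d hd, sub_self, map_zero, map_zero, sub_self]
  have hf_perp : ∀ y, ∀ d ∈ N, cupProduct h4 (f y) d = 0 := fun y d hd ↦ by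
    rw [hf]
    exact hπorth _ d hd
  obtain ⟨a, b, hab⟩ := hU f hf_rat hf_typ hf_N hf_perp
  -- on `T`: `F = a + b e`
  have hFT : ∀ y, (∀ d ∈ N, cupProduct h4 y d = 0) → F y = (a : ℂ) • y + (b : ℂ) • e y := by
    intro y hy
    have hπy : π y = 0 := hπT y hy
    have hπFy : π (F y) = 0 := hπT _ (hF_T y hy)
    have h := hab y hy
    rw [hf, hπy, sub_zero, hπFy, sub_zero] at h
    exact h
  -- `F₁ = F - a - b e` kills `T`
  set F₁ : complexBetti S (2 * 1) →ₗ[ℂ] complexBetti S (2 * 1) :=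
    F - (a : ℂ) • LinearMap.id - (b : ℂ) • e with hF₁def
  have hF₁ : ∀ y, F₁ y = F y - (a : ℂ) • y - (b : ℂ) • e y := fun y ↦ by
    simp only [hF₁def, LinearMap.sub_apply, LinearMap.smul_apply, LinearMap.id_apply]
  have hF₁T : ∀ y, (∀ d ∈ N, cupProduct h4 y d = 0) → F₁ y = 0 := fun y hy ↦ by
    rw [hF₁, hFT y hy, add_sub_cancel_left, sub_self]
  -- a rational basis of `N` with its Gram inverse, the classes `cᵢ = F₁ dᵢ ∈ N` and the dual basis
  obtain ⟨r, d, M, hdQ, hdN, hdli, hspanN, hmulinv, hinvmul⟩ := exists_neronSeveri_gramBasis hS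
  have hmemS : ∀ x ∈ N, x ∈ Submodule.span ℂ (Set.range d) := fun x hx ↦ by rw [hspanN]; exact hx
  set c : Fin r → complexBetti S (2 * 1) := fun i ↦ F₁ (d i) with hcdef
  have hcQ : ∀ i, IsRationalClass (c i) := fun i ↦ by
    simp only [hcdef, hF₁]
    exact isRationalClass_sub (isRationalClass_sub (hF_rat _ (hdQ i)) ((hdQ i).smul a)) ((he_rat _ (hdQ i)).smul b)
  have hc11 : ∀ i, IsOfHodgeType 2 S (2 * 1) 1 1 (c i) := fun i ↦ by
    simp only [hcdef, hF₁, he_N _ (hdN i), smul_zero, sub_zero]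
    exact (hF_typ 1 1 _ (hN11 _ (hdN i))).sub hS ((hN11 _ (hdN i)).smul _)
  have hcN : ∀ i, c i ∈ N := fun i ↦ hL11 _ (hcQ i) (hc11 i)
  set dv : Fin r → complexBetti S (2 * 1) := fun i ↦ ∑ j, ((M i j : ℚ) : ℂ) • d j with hdvdef
  have hdvN : ∀ i, dv i ∈ N := fun i ↦ Submodule.sum_mem _ fun j _ ↦ Submodule.smul_mem _ _ (hdN j)
  -- the linear map `G₁ y = Σᵢ (∫ y ∪ dᵢ^∨) cᵢ` equals `F₁`
  have hsymm : ∀ x y : complexBetti S (2 * 1), cupProduct h4 x y = cupProduct h4 y x := fun x y ↦ by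
    rw [cupProduct_gradedComm_holds ℂ _ h4 h4]
    norm_num
  have htdv : ∀ i k, traceC hS (cupProduct h4 (d k) (dv i)) = if i = k then 1 else 0 := by
    intro i k
    simp only [hdvdef, map_sum, map_smul, smul_eq_mul]
    rw [← hinvmul i k]
    refine Finset.sum_congr rfl fun j _ ↦ ?_
    rw [hsymm (d k) (d j)]
  let G₁ : complexBetti S (2 * 1) →ₗ[ℂ] complexBetti S (2 * 1) :=
    ∑ i, ((traceC hS) ∘ₗ ((cupProduct h4).flip (dv i))).smulRight (c i)
  have hG₁ : ∀ y, G₁ y = ∑ i, traceC hS (cupProduct h4 y (dv i)) • c i := fun y ↦ by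
    simp only [G₁, LinearMap.sum_apply, LinearMap.smulRight_apply, LinearMap.comp_apply,
      LinearMap.flip_apply]
  have hG₁d : ∀ k, G₁ (d k) = F₁ (d k) := fun k ↦ by
    rw [hG₁]
    simp_rw [htdv]
    simp [ite_smul, Finset.sum_ite_eq', hcdef]
  have hG₁N : ∀ x ∈ N, G₁ x = F₁ x := by
    intro x hx
    refine Submodule.span_induction (p := fun x _ ↦ G₁ x = F₁ x) ?_ ?_ ?_ ?_ (hmemS x hx)
    · rintro _ ⟨k, rfl⟩
      exact hG₁d k
    · rw [map_zero, map_zero]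
    · intro x y _ _ hx hy
      rw [map_add, map_add, hx, hy]
    · intro t x _ hx
      rw [map_smul, map_smul, hx]
  have hG₁T : ∀ y, (∀ d ∈ N, cupProduct h4 y d = 0) → G₁ y = 0 := fun y hy ↦ by
    rw [hG₁]
    exact Finset.sum_eq_zero fun i _ ↦ by rw [hy _ (hdvN i), map_zero, zero_smul]
  have hG₁F₁ : ∀ y, G₁ y = F₁ y := fun y ↦ by
    have hy : y = π y + (y - π y) := by abel
    rw [hy, map_add, map_add, hG₁N _ (hπN y), hG₁T _ (hπorth y), hF₁T _ (hπorth y)]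
  -- fibre integration: `pr₁_*(pr₂^* ω) = κ • 1`, `κ ≠ 0`, for `ω` of trace one
  obtain ⟨ω, hω⟩ := exists_traceC_eq_one hS
  have hω0 : ω ≠ 0 := by
    rintro rfl
    rw [map_zero] at hω
    exact zero_ne_one hω
  obtain ⟨κ, hκ0, hκ⟩ := exists_fibreIntegral_fst μ hS hS (kunnethSpan_complexBetti hS hS (2 * (2 + 2)))
    hω0 (rfl : 2 * 2 + 2 * 2 = 0 + 2 * (2 + 2))
  -- the algebraic class `Γ₁ = Σᵢ pr₁^* cᵢ ∪ pr₂^* dᵢ^∨` acts as `κ G₁`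
  set Γ₁ : complexBetti (S ⊗ S) (2 * 2) :=
    ∑ i, cupProduct h4 (complexBetti.map (fst S S) (2 * 1) (c i)) (complexBetti.map (snd S S) (2 * 1) (dv i))
    with hΓ₁def
  have hΓ₁alg : Γ₁ ∈ algebraicClasses (S ⊗ S) 2 :=
    Submodule.sum_mem _ fun i _ ↦
      cupProduct_fst_snd_mem_algebraicClasses_of_eq hS hS (hcN i) (hdvN i) (rfl : 1 + 1 = 2) h4
  have hΓ₁act : ∀ y, Corr[μ, hS ; Γ₁, y] = κ • G₁ y := by
    intro y
    rw [hG₁, Finset.smul_sum, hΓ₁def, map_sum, map_sum]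
    refine Finset.sum_congr rfl fun i _ ↦ ?_
    rw [corrFst_cross_of_cup_eq μ hS hS h4 (rfl : 2 * 1 + 2 * 2 = 2 * 1 + 2 * 2) h4
      (rfl : 2 * 1 + 2 * 2 + 2 * 2 = 2 * 1 + 2 * (2 + 2)) (rfl : 2 * 2 + 2 * 2 = 0 + 2 * (2 + 2)) hκ
      (c i) (eq_traceC_smul hS hω (cupProduct h4 y (dv i))), smul_smul]
    congr 1
    rw [show ((-1 : ℂ) ^ (2 * 1 * (2 * 1))) = 1 by norm_num, one_mul, mul_comm]
  -- the diagonal and the class of `e`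
  obtain ⟨γ, hγalg, hγ⟩ := hγe
  set δ : complexBetti (S ⊗ S) (2 * 2) :=
    complexGysin μ hS hSS (lift (𝟙 S) (𝟙 S)) (rfl : 0 + 2 * (2 + 2) = 2 * 2 + 2 * 2)
      (singularCohomology.one ℂ (ComplexPoints S)) with hδdef
  have hδalg : δ ∈ algebraicClasses (S ⊗ S) 2 := diagonal_mem_algebraicClasses μ hS _
  have hδact : ∀ y : complexBetti S (2 * 1), Corr[μ, hS ; δ, y] = y := fun y ↦
    corrFst_diagonal μ hS (rfl : 2 * 1 + 2 * 2 = 2 * 1 + 2 * 2)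
      (rfl : 2 * 1 + 2 * 2 + 2 * 2 = 2 * 1 + 2 * (2 + 2)) (rfl : 0 + 2 * (2 + 2) = 2 * 2 + 2 * 2) y
  -- the class `Γ`
  refine ⟨u⁻¹ • (κ⁻¹ • Γ₁ + (a : ℂ) • δ + (b : ℂ) • γ), Submodule.smul_mem _ _
    (Submodule.add_mem _ (Submodule.add_mem _ (Submodule.smul_mem _ _ hΓ₁alg) (Submodule.smul_mem _ _ hδalg))
      (Submodule.smul_mem _ _ hγalg)), fun y ↦ ?_⟩
  have hlin : Corr[μ, hS ; u⁻¹ • (κ⁻¹ • Γ₁ + (a : ℂ) • δ + (b : ℂ) • γ), y] =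
      u⁻¹ • (κ⁻¹ • Corr[μ, hS ; Γ₁, y] + (a : ℂ) • Corr[μ, hS ; δ, y] + (b : ℂ) • Corr[μ, hS ; γ, y]) := by
    simp only [map_add, map_smul]
  rw [hlin, hΓ₁act, hδact, ← hγ y, smul_smul, inv_mul_cancel₀ hκ0, one_smul, hG₁F₁, hF₁]
  have hFy : F y = u • Corr[μ, hS ; z, y] := hF y
  rw [show F y - (a : ℂ) • y - (b : ℂ) • e y + (a : ℂ) • y + (b : ℂ) • e y = F y by abel, hFy, smul_smul,
    inv_mul_cancel₀ hu0, one_smul]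

end Summit.HodgeConjecture.HodgeConjecture.Theorems.NikulinTwinTransport.SquareGlueFree

end
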